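import Literature.MeasureTheory.Group.HaarLocalChartLeft
import HarnessLib

/-!
# The reflection of a left Haar measure: `(Δ · μ)̌ = μ` for Mathlib's modular character `Δ`

[Folland1995] G. B. Folland, *A Course in Abstract Harmonic Analysis* (1995), §2.4, Prop. 2.24, Prop. 2.31, (2.32) (`dx⁻¹ = Δ(x⁻¹) dx`);
[BourbakiINT7] N. Bourbaki, *Intégration*, Chap. VII §1 n° 3–4.  Topic `MeasureTheory/Group`; namespace `Literature.MeasureTheory.Group`.
THEOREMS ONLY (no definition, no instance, no notation, no `sorry`).  A locally compact, second countable, Hausdorff group `G` with a left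
Haar measure `μ` and MATHLIB's modular character `Δ = MeasureTheory.Measure.modularCharacter : G →* ℝ≥0`, whose convention is
`(· g)_* μ = Δ(g) • μ` (★ `map_mul_right_eq_modularCharacter_smul`; the classical modular function is `Δ⁻¹`).  This file supplies the Mathlib
`TODO`-adjacent fact that the REFLECTION `μ̌ = inv_* μ` of `μ` is `Δ⁻¹ · μ`, in the form `(Δ · μ)̌ = μ`:

* §1 `isMulRightInvariant_withDensity_modularCharacter` — `Δ · μ` is right-invariant; `isFiniteMeasureOnCompacts_withDensity_modularCharacter`
  (`Δ` is bounded on compacta by `μ(U K⁻¹)/μ(U)`, ★ `HaarLocalChartLeft.measure_preimage_mul_right_eq_modularCharacter_mul`).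
* §2 **`inv_withDensity_modularCharacter_eq : (μ.withDensity Δ).inv = μ`** — `(Δ·μ)̌` is left-invariant and finite on compacta, so `= c • μ`
  (Mathlib `isMulLeftInvariant_eq_smul`); testing on `Δ · (𝟙_K ∘ inv)` for a compact neighbourhood `K` of `1` gives `c² = 1`.
* §3 consequences: `lintegral_modularCharacter_mul_comp_inv` (`∫⁻ Δ(x) f(x⁻¹) dμ = ∫⁻ f dμ`), `integral_modularCharacter_smul_comp_inv`
  (`∫ Δ(x) • F(x⁻¹) dμ = ∫ F dμ`, any `F : G → E`, Bochner), `integral_modularCharacter_mul_comp_inv` (complex-valued form).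
USE: the last is exactly the hypothesis `IsModularWeight P ν Δ_P` of ★ `Literature/RepresentationTheory/WeilBruhatInvariantIntegral` (the Weil–Bruhat
invariant integral on `G/P`), discharged for every closed subgroup `P` of a second countable locally compact group with its own Haar measure.
Cell hodgecm-mathlib, half A line LD2, plate (S3′) of LD2-plan (g2); `--supports stmt-HodgeConjecture-24832`; pure measure theory; count-neutral.

## References
* [Folland1995] G. B. Folland, *A Course in Abstract Harmonic Analysis*, CRC Press (1995), §2.4 Prop. 2.24, Prop. 2.31, (2.32).
* [BourbakiINT7] N. Bourbaki, *Intégration, Chap. VII–VIII*, Chap. VII §1 n° 3–4.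
-/

set_option autoImplicit false

noncomputable section

open MeasureTheory MeasureTheory.Measure
open scoped NNReal ENNReal Pointwise

namespace Literature.MeasureTheory.Group

section Reflection

variable {G : Type*} [Group G] [TopologicalSpace G] [IsTopologicalGroup G] [LocallyCompactSpace G]
  [SecondCountableTopology G] [T2Space G] [MeasurableSpace G] [BorelSpace G] (μ : Measure G) [IsHaarMeasure μ]

omit [SecondCountableTopology G] [T2Space G] [MeasurableSpace G] [BorelSpace G] in
/-- `Δ(g) ≠ 0` in `ℝ≥0∞`. [cite: Folland1995, §2.4 Prop. 2.24] -/
theorem coe_modularCharacter_ne_zero (g : G) : (modularCharacter g : ℝ≥0∞) ≠ 0 :=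
  ENNReal.coe_ne_zero.2 (modularCharacterFun_pos g).ne'

omit [T2Space G] in
/-- **`Δ · μ` is RIGHT-invariant** for a left Haar measure `μ` and Mathlib's modular character `Δ` (`(· g)_* μ = Δ(g) μ` and
`Δ(x g) = Δ(x) Δ(g)`). [cite: Folland1995, §2.4 Prop. 2.24, (2.32)] -/
theorem isMulRightInvariant_withDensity_modularCharacter :
    (μ.withDensity fun x => (modularCharacter x : ℝ≥0∞)).IsMulRightInvariant := by
  refine ⟨fun g => ?_⟩
  have hΔ : Measurable fun x : G => (modularCharacter x : ℝ≥0∞) := HaarLocalChartLeft.measurable_coe_modularCharacter μ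
  ext A hA
  rw [Measure.map_apply (measurable_mul_const g) hA, withDensity_apply _ (measurable_mul_const g hA), withDensity_apply _ hA,
    ← lintegral_indicator (measurable_mul_const g hA), ← lintegral_indicator hA]
  have hpt : ∀ x : G, ((fun y => y * g) ⁻¹' A).indicator (fun x => (modularCharacter x : ℝ≥0∞)) x =
      (modularCharacter g : ℝ≥0∞)⁻¹ * A.indicator (fun x => (modularCharacter x : ℝ≥0∞)) (x * g) := by
    intro x
    by_cases hx : x * g ∈ A
    · rw [Set.indicator_of_mem (show x ∈ (fun y => y * g) ⁻¹' A from hx), Set.indicator_of_mem hx, map_mul, ENNReal.coe_mul,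
        ← mul_assoc, mul_comm ((modularCharacter g : ℝ≥0∞))⁻¹, mul_assoc, ENNReal.inv_mul_cancel (coe_modularCharacter_ne_zero g)
        ENNReal.coe_ne_top, mul_one]
    · rw [Set.indicator_of_notMem (show x ∉ (fun y => y * g) ⁻¹' A from hx), Set.indicator_of_notMem hx, mul_zero]
  simp only [hpt]
  rw [lintegral_const_mul _ (show Measurable (fun a : G => A.indicator (fun x => (modularCharacter x : ℝ≥0∞)) (a * g)) from
      (hΔ.indicator hA).comp (measurable_mul_const g)),
    ← lintegral_map (hΔ.indicator hA) (measurable_mul_const g), map_mul_right_eq_modularCharacter_smul μ g,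
    lintegral_smul_measure, ENNReal.smul_def, smul_eq_mul, ← mul_assoc,
    ENNReal.inv_mul_cancel (coe_modularCharacter_ne_zero g) ENNReal.coe_ne_top, one_mul]

/-- `Δ · μ` is finite on compact sets (`Δ` is bounded on compacta: `Δ(x) μ(U) = μ(U x⁻¹) ≤ μ(U K⁻¹)` for `x ∈ K`).
[cite: Folland1995, §2.4 Prop. 2.24] -/
theorem isFiniteMeasureOnCompacts_withDensity_modularCharacter :
    IsFiniteMeasureOnCompacts (μ.withDensity fun x => (modularCharacter x : ℝ≥0∞)) := by
  refine ⟨fun K hK => ?_⟩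
  obtain ⟨U, hUc, h1U⟩ := exists_compact_mem_nhds (1 : G)
  have hUm : MeasurableSet (interior U) := isOpen_interior.measurableSet
  have hUpos : μ (interior U) ≠ 0 := (isOpen_interior.measure_pos μ ⟨1, mem_interior_iff_mem_nhds.2 h1U⟩).ne'
  have hUtop : μ (interior U) ≠ ∞ := (lt_of_le_of_lt (measure_mono interior_subset) hUc.measure_lt_top).ne
  -- bound: Δ x ≤ μ(U K⁻¹) / μ(interior U) on K
  have hbound : ∀ x ∈ K, (modularCharacter x : ℝ≥0∞) ≤ μ (U * K⁻¹) / μ (interior U) := by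
    intro x hx
    have h := HaarLocalChartLeft.measure_preimage_mul_right_eq_modularCharacter_mul μ hUm x
    have hsub : (fun g => g * x) ⁻¹' interior U ⊆ U * K⁻¹ := by
      intro g hg
      exact Set.mem_mul.2 ⟨g * x, interior_subset hg, x⁻¹, Set.inv_mem_inv.2 hx, by group⟩
    rw [ENNReal.le_div_iff_mul_le (Or.inl hUpos) (Or.inl hUtop), ← h]
    exact measure_mono hsub
  rw [withDensity_apply _ hK.measurableSet]
  calc ∫⁻ x in K, (modularCharacter x : ℝ≥0∞) ∂μ
      ≤ ∫⁻ _ in K, μ (U * K⁻¹) / μ (interior U) ∂μ := setLIntegral_mono measurable_const hbound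
    _ = μ (U * K⁻¹) / μ (interior U) * μ K := by rw [setLIntegral_const]
    _ < ∞ := ENNReal.mul_lt_top (ENNReal.div_lt_top (hUc.mul hK.inv).measure_lt_top.ne hUpos) hK.measure_lt_top

/-- **THE REFLECTION OF A LEFT HAAR MEASURE**: `(Δ · μ)̌ = μ`, i.e. `∫ Δ(x) f(x⁻¹) dμ(x) = ∫ f dμ` — with MATHLIB's modular character
`Δ = Measure.modularCharacter` (`(· g)_* μ = Δ(g) μ`; the classical modular function is `Δ⁻¹`).  Proof: `(Δ·μ)̌` is left-invariant and
finite on compacta, hence `c · μ`; applying the identity to `x ↦ Δ(x) f(x⁻¹)` gives `c² = 1`. [cite: Folland1995, §2.4 Prop. 2.31–(2.32)] -/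
theorem inv_withDensity_modularCharacter_eq : (μ.withDensity fun x => (modularCharacter x : ℝ≥0∞)).inv = μ := by
  have hΔ : Measurable fun x : G => (modularCharacter x : ℝ≥0∞) := HaarLocalChartLeft.measurable_coe_modularCharacter μ
  set m : Measure G := μ.withDensity fun x => (modularCharacter x : ℝ≥0∞) with hm
  haveI : m.IsMulRightInvariant := isMulRightInvariant_withDensity_modularCharacter μ
  haveI : IsFiniteMeasureOnCompacts m := isFiniteMeasureOnCompacts_withDensity_modularCharacter μ
  have huniq := isMulLeftInvariant_eq_smul m.inv μ
  set c : ℝ≥0 := haarScalarFactor m.inv μ with hc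
  -- (*) `∫⁻ Δ f(·⁻¹) dμ = c ∫⁻ f dμ`
  have star : ∀ f : G → ℝ≥0∞, Measurable f → ∫⁻ x, (modularCharacter x : ℝ≥0∞) * f x⁻¹ ∂μ = c * ∫⁻ x, f x ∂μ := by
    intro f hf
    have h1 : ∫⁻ x, f x ∂m.inv = ∫⁻ x, (modularCharacter x : ℝ≥0∞) * f x⁻¹ ∂μ := by
      rw [Measure.inv_def, lintegral_map hf measurable_inv, hm,
        lintegral_withDensity_eq_lintegral_mul _ hΔ (show Measurable (fun a : G => f a⁻¹) from hf.comp measurable_inv)]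
      rfl
    rw [← h1, huniq, lintegral_smul_measure, ENNReal.smul_def, smul_eq_mul]
  -- `c² = 1` by the involution `f ↦ Δ · (f ∘ inv)` on a compact neighbourhood of `1`
  obtain ⟨K, hKc, h1K⟩ := exists_compact_mem_nhds (1 : G)
  have hKpos : μ K ≠ 0 := (measure_pos_of_mem_nhds μ h1K).ne'
  have hKtop : μ K ≠ ∞ := hKc.measure_lt_top.ne
  have hf₁ : Measurable (K.indicator fun _ => (1 : ℝ≥0∞)) := measurable_const.indicator hKc.measurableSet
  have hf₂ : Measurable fun x : G => (modularCharacter x : ℝ≥0∞) * K.indicator (fun _ => (1 : ℝ≥0∞)) x⁻¹ :=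
    hΔ.mul (hf₁.comp measurable_inv)
  have e₂ := star _ hf₂
  have e₁ := star _ hf₁
  simp only [inv_inv] at e₂
  have hsimp : ∀ x : G, (modularCharacter x : ℝ≥0∞) * ((modularCharacter x⁻¹ : ℝ≥0∞) * K.indicator (fun _ => (1 : ℝ≥0∞)) x) =
      K.indicator (fun _ => (1 : ℝ≥0∞)) x := fun x => by
    rw [← mul_assoc, ← ENNReal.coe_mul, ← map_mul, mul_inv_cancel, map_one, ENNReal.coe_one, one_mul]
  have hI : ∫⁻ x, K.indicator (fun _ => (1 : ℝ≥0∞)) x ∂μ = μ K := by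
    rw [lintegral_indicator hKc.measurableSet, setLIntegral_const, one_mul]
  simp only [hsimp] at e₂
  rw [e₁, hI, ← mul_assoc] at e₂
  -- e₂ : μ K = c * c * μ K
  have hcc : (c : ℝ≥0∞) * c = 1 := by
    have h2 : (c : ℝ≥0∞) * c * μ K = 1 * μ K := by rw [one_mul]; exact e₂.symm
    exact (ENNReal.mul_left_inj hKpos hKtop).1 h2
  have hcc' : c * c = 1 := by exact_mod_cast hcc
  have hc1 : c = 1 := by
    have h' : (c : ℝ) * c = 1 := by exact_mod_cast hcc'
    rcases mul_self_eq_one_iff.1 h' with h | h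
    · exact_mod_cast h
    · have h0 : (0 : ℝ) ≤ c := c.2
      linarith
  rw [huniq, hc1, one_smul]

/-- **`∫⁻ Δ(x) f(x⁻¹) dμ(x) = ∫⁻ f dμ`** for Borel `f ≥ 0`. [cite: Folland1995, §2.4 (2.32)] -/
theorem lintegral_modularCharacter_mul_comp_inv {f : G → ℝ≥0∞} (hf : Measurable f) :
    ∫⁻ x, (modularCharacter x : ℝ≥0∞) * f x⁻¹ ∂μ = ∫⁻ x, f x ∂μ := by
  have hΔ : Measurable fun x : G => (modularCharacter x : ℝ≥0∞) := HaarLocalChartLeft.measurable_coe_modularCharacter μ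
  conv_rhs => rw [← inv_withDensity_modularCharacter_eq μ]
  rw [Measure.inv_def, lintegral_map hf measurable_inv,
    lintegral_withDensity_eq_lintegral_mul _ hΔ (show Measurable (fun a : G => f a⁻¹) from hf.comp measurable_inv)]
  rfl

/-- **`∫ Δ(x) • F(x⁻¹) dμ(x) = ∫ F dμ`** for every `F : G → E` (Bochner; no integrability hypothesis — both sides are `0` together).
[cite: Folland1995, §2.4 (2.32)] -/
theorem integral_modularCharacter_smul_comp_inv {E : Type*} [NormedAddCommGroup E] [NormedSpace ℝ E] (F : G → E) :
    ∫ x, (modularCharacter x : ℝ≥0) • F x⁻¹ ∂μ = ∫ x, F x ∂μ := by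
  have hΔ : Measurable fun x : G => (modularCharacter x : ℝ≥0) :=
    measurable_coe_nnreal_ennreal_iff.1 (HaarLocalChartLeft.measurable_coe_modularCharacter μ)
  conv_rhs => rw [← inv_withDensity_modularCharacter_eq μ]
  rw [Measure.inv_def, show (Inv.inv : G → G) = ⇑(MeasurableEquiv.inv G) from rfl, integral_map_equiv,
    integral_withDensity_eq_integral_smul hΔ]

/-- **`∫ Δ(x) F(x⁻¹) dμ(x) = ∫ F dμ`** for complex-valued `F` (the form used by the Weil–Bruhat invariant integral:
`Δ` is a modular weight for `μ`). [cite: Folland1995, §2.4 (2.32)] -/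
theorem integral_modularCharacter_mul_comp_inv (F : G → ℂ) :
    ∫ x, ((modularCharacter x : ℝ) : ℂ) * F x⁻¹ ∂μ = ∫ x, F x ∂μ := by
  rw [← integral_modularCharacter_smul_comp_inv μ F]
  refine integral_congr_ae (Filter.Eventually.of_forall fun x => ?_)
  simp only [NNReal.smul_def, Complex.real_smul]

end Reflection

end Literature.MeasureTheory.Group

end
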